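import Literature.NumberTheory.Li1992.RallisInnerProductCharacterLift
import Literature.NumberTheory.Li1992.SchwartzPairingFactorisation
import Literature.NumberTheory.Automorphic.UnitaryGroupAdelicProductHaar
import HarnessLib

/-!
# Non-vanishing of the theta lift `Θ_{Φ_∞ ⊗ Φ_f}(χ)` of an automorphic character of `U(W)`, from Rallis' formula
# [Li1992, Thm 2.1 (26)–(27)]: REDUCTION TO ONE FINITE-ADELIC FOURIER COEFFICIENT

J.-S. Li, *Non-vanishing theorems for the cohomology of certain arithmetic quotients*, J. reine angew. Math. **428** (1992)
[Li1992], Thm 2.1 (26) and its factorised form (27) p. 184 («the product over all places `v` of the local integrals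
`∫_{G'_v} ⟨ω_v(h_v)φ_v, φ_v⟩ ⟨π_v(h_v) f_v, f_v⟩ dh_v`»), §5 (local non-vanishing); [Liu2021, proof of Prop. 4.13, l. 2145;
App. D Lem. D.2 (2)] (the use: the theta lift of `χ` with the HARMONIC archimedean vector is non-zero).

Topic `NumberTheory/Li1992`; namespace `Literature.NumberTheory.GelbartRogawski1991.UnitaryDualPair` (the constructed pair
`U(J_V) × U(J_W)` of [GelbartRogawski1991, §3.1]).  KERNEL file: THEOREMS ONLY; it ASSEMBLES, for the tree's adelic Weil
representation `pairRep s = ω_ψ ∘ s_pair` on `𝒮(𝔸_Fⁿ)` and its theta-kernel datum `UnitaryDualPair.thetaKernelDatum … s hs hρ SK hSK`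
(`M.W.act (M.s (1, h)) = pairRep s (1, h)`, tree `thetaKernelDatum_act_s`, `rfl`):

* the function-side `∞ ⊔ f` factorisation `Li1992/SchwartzPairingFactorisation` (`⟨Φ_∞ ⊗ Φ_f, Ψ_∞ ⊗ Ψ_f⟩ = c·⟨Φ_∞,Ψ_∞⟩_∞·⟨Φ_f,Ψ_f⟩_f`),
* the group-side one `Automorphic/UnitaryGroupAdelicProductHaar` (`dh = κ · dh_∞ ⊗ dh_f` on
  `U(W)(𝔸_F) ≃ U(W)(E ⊗ ℝ) × U(W)(𝔸_{F,f})`, tree `UnitaryGroup.adelicProdEquiv`),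
* and the polarised criterion `Li1992/RallisInnerProductCharacterLift`
  (`RallisInnerProductIdentity.thetaLift_charCM_ne_zero_of_fourierCoeff_ne_zero`),

UNDER the explicitly displayed operator hypothesis **`hω`**: restricted to the second member `U(W)(𝔸_F)`, `ω_ψ ∘ s_pair` acts on
factorizable vectors factor by factor, `ω(s_pair(1, h_∞·h_f))(Φ_∞ ⊗ Φ_f) = ω_∞(h_∞)Φ_∞ ⊗ ω_f(h_f)Φ_f` for SOME representations
`ω_∞` of `U(W)(E ⊗ ℝ)` on `𝓢((F ⊗ ℝ)ⁿ)` and `ω_f` of `U(W)(𝔸_{F,f})` on `𝒮((𝔸_{F,f})ⁿ)` ([Weil1964, n° 37–39]: `𝐫_𝐀 = ⊗_v 𝐫_v`; in the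
tree the finite half is `WeilCoinv.pairRep_finPairToAdelic_piSBReindex_tmul` with `ω_f = finPairRepW`, the archimedean half is
`Weil1964.archRepMp` — their junction into `hω` is NOT done here).  Results:

* §1 `exists_integral_coeff_pairRep_eq` — **`∫_{U(W)(𝔸)} ⟨ω(s_pair(1,h))(Φ_∞ ⊗ Φ_f), Ψ_∞ ⊗ Ψ_f⟩ · w_∞(h_∞) w_f(h_f) dh
  = κ · c · (∫_{U(W)(E⊗ℝ)} ⟨ω_∞(a)Φ_∞, Ψ_∞⟩_∞ w_∞(a) da) · (∫_{U(W)(𝔸_{F,f})} ⟨ω_f(b)Φ_f, Ψ_f⟩_f w_f(b) db)`** — (27) with the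
  places grouped as `∞ ⊔ f`, one `κ > 0` (Haar normalisations) for all vectors and weights;
* §2 `exists_integral_coeff_pairRep_eq_of_eigen` / `…_ne_zero_iff` — when `Φ_∞` is an `ω_∞`-EIGENVECTOR with unitary
  eigencharacter `χ_∞` (the harmonic vector of [Liu2021, Lem. D.2 (2)]; `χ_∞ = 1` for Liu's characters `χ ∈ Chi`, which are
  trivial at `∞`) and `w_∞ = \overline{χ_∞}`: the `U(W)(𝔸)`-coefficient is `κ·c·vol(U(W)(E⊗ℝ))·⟨Φ_∞, Ψ_∞⟩_∞` times the FINITE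
  coefficient, and (for `⟨Φ_∞,Ψ_∞⟩_∞ ≠ 0`, `vol < ∞`) is non-zero IFF the finite coefficient is;
* §3 **`thetaLift_charCM_tmul_ne_zero_of_finCoeff_ne_zero`** — THE REDUCTION: if Rallis' identity (26) holds for the datum
  (`hR`, the conclusion of the named fact `Li1992.RallisInnerProductFormulaUnitaryDualPair`), `hω`, the automorphic character
  `χ̃` of `[U(W)] = U(W)(𝔸) ⧸ U(W)(F)` reads `\overline{χ̃(h̄)} = \overline{χ_∞(h_∞)} · w_f(h_f)`, `Φ_∞` is a `χ_∞`-eigenvector with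
  `⟨Φ_∞, Ψ_∞⟩_∞ ≠ 0`, and ONE finite Fourier coefficient `∫_{U(W)(𝔸_{F,f})} ⟨ω_f(b)Φ_f, Ψ_f⟩_f w_f(b) db ≠ 0`, then
  **`Θ_{Φ_∞ ⊗ Φ_f}(χ̃) ≠ 0`** (and `Θ_{Ψ_∞ ⊗ Ψ_f}(χ̃) ≠ 0`).  What is left to a consumer at the pin of [Liu2021, Prop. 4.13] is
  exactly: S6 (`hR`), the junction `hω`, the character junction, the archimedean eigen-data, and the finite non-vanishing
  ([Li1992, §5] / local occupancy) — each a displayed hypothesis, none asserted.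

## Mathlib / tree search
Tree: `UnitaryDualPair.pairRep`, `thetaKernelDatum`, `thetaKernelDatum_act_s` (`UnitaryDualPairThetaKernel`); `adelicProdEquiv`,
`archPart`, `finPart`, `archToAdelic_mul_finAdelicToAdelic` (`UnitaryGroupAdelicProduct`); bricks `schwartzPairing_tmul_tmul`,
`UnitaryGroup.exists_integral_archPart_mul_finPart`, `RallisInnerProductIdentity.thetaLift_charCM_ne_zero_of_fourierCoeff_ne_zero`.
No prior statement combining them (`lean search 'archPart.*schwartzPairing'` empty).

## References
* [Li1992] J.-S. Li, J. reine angew. Math. 428 (1992), Thm 2.1 (26)–(27) p. 184; §5.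
* [Liu2021] Y. Liu, Camb. J. Math. 9 (2021), proof of Prop. 4.13 (l. 2145); Def. 4.11; App. D Lem. D.2 (2).
* [Weil1964] A. Weil, Acta Math. 111 (1964), Chap. III n° 37–39, 41.
* [GelbartRogawski1991] S. Gelbart, J. Rogawski, Invent. Math. 105 (1991), §3.1–3.2.
-/

set_option autoImplicit false

noncomputable section

open _root_.MeasureTheory NumberField NumberField.mixedEmbedding IsDedekindDomain
open scoped ComplexConjugate TensorProduct SchwartzMap NNReal Classical
open Literature.NumberTheory.Automorphic Literature.NumberTheory.Weil1964 Literature.NumberTheory.Li1992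
open Literature.RepresentationTheory.CompactGroups

namespace Literature.NumberTheory.GelbartRogawski1991.UnitaryDualPair

variable (F E : Type) [Field F] [NumberField F] [Field E] [NumberField E] [Algebra F E]
variable (c : E ≃ₐ[F] E) (N M : ℕ) {n : ℕ} (e : Fin N × Fin M ≃ Fin n)
variable (JV : Matrix (Fin N) (Fin N) E) (JW : Matrix (Fin M) (Fin M) E)
variable {TV : Matrix (Fin N) (Fin N) F} {TW : Matrix (Fin M) (Fin M) F}
variable (s : UnitaryGroup.adelicPair F E c N M JV JW →* adelicMpCont F (Fin n) (adelicGram F e TV TW))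
-- the `L²(X(A))` measure, read as `c · split_*(μ_∞ ⊗ μ_f)` (`exists_haar_eq_smul_map_prod`)
variable [MeasurableSpace (AdeleRing (𝓞 F) F)] [BorelSpace (AdeleRing (𝓞 F) F)]
  [MeasurableSpace (FiniteAdeleRing (𝓞 F) F)] [BorelSpace (FiniteAdeleRing (𝓞 F) F)]
  {νX : Measure (Fin n → AdeleRing (𝓞 F) F)} {μE : Measure (Fin n → mixedSpace F)}
  {μfX : Measure (Fin n → FiniteAdeleRing (𝓞 F) F)} {cX : ℝ≥0}
-- Haar measures on `U(W)(𝔸)`, `U(W)(E ⊗ ℝ)`, `U(W)(𝔸_{F,f})`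
variable [MeasurableSpace (UnitaryGroup.adelic F E c M JW)] [MeasurableSpace (UnitaryGroup.arch F E c M JW)]
  [MeasurableSpace (UnitaryGroup.finAdelic F E c M JW)]
  (dh : Measure (UnitaryGroup.adelic F E c M JW)) (μa : Measure (UnitaryGroup.arch F E c M JW))
  (μf : Measure (UnitaryGroup.finAdelic F E c M JW))
-- the two local Weil representations of the second member and the factorisation hypothesis `hω`
variable (ωinf : Representation ℂ (UnitaryGroup.arch F E c M JW) 𝓢((Fin n → mixedSpace F), ℂ))
  (ωfin : Representation ℂ (UnitaryGroup.finAdelic F E c M JW) (FinSB F (Fin n)))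

/-! ## §1 (27) for the second member, places grouped as `∞ ⊔ f` -/

/-- **`∫_{U(W)(𝔸)} ⟨ω(s_pair(1,h))(Φ_∞ ⊗ Φ_f), Ψ_∞ ⊗ Ψ_f⟩ w_∞(h_∞) w_f(h_f) dh
= κ·c·(∫ ⟨ω_∞(a)Φ_∞,Ψ_∞⟩_∞ w_∞(a) dμ_∞)·(∫ ⟨ω_f(b)Φ_f,Ψ_f⟩_f w_f(b) dμ_f)`**, one `κ > 0` for all vectors and weights, UNDER the
factorisation hypothesis `hω` on `ω_ψ ∘ s_pair` restricted to `U(W)(𝔸)`. [cite: Li1992, Thm 2.1 (27) p. 184]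
[cite: Weil1964, Chap. III n° 37–39] -/
theorem exists_integral_coeff_pairRep_eq [SFinite μE] [SFinite μfX]
    (hνX : νX = cX • (μE.prod μfX).map (piAdeleSplit F (Fin n)))
    [BorelSpace (UnitaryGroup.adelic F E c M JW)] [BorelSpace (UnitaryGroup.arch F E c M JW)]
    [BorelSpace (UnitaryGroup.finAdelic F E c M JW)] [dh.IsHaarMeasure] [μa.IsHaarMeasure] [μf.IsHaarMeasure]
    (hω : ∀ (a : UnitaryGroup.arch F E c M JW) (b : UnitaryGroup.finAdelic F E c M JW)
      (Φinf : 𝓢((Fin n → mixedSpace F), ℂ)) (Φfin : FinSB F (Fin n)),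
      pairRep F E c N M e JV JW s (1, UnitaryGroup.archToAdelic F E c M JW a * UnitaryGroup.finAdelicToAdelic F E c M JW b)
          (piSchwartzBruhatEquiv F (Fin n) (Φinf ⊗ₜ Φfin)) =
        piSchwartzBruhatEquiv F (Fin n) (ωinf a Φinf ⊗ₜ ωfin b Φfin)) :
    ∃ κ : ℝ≥0, 0 < κ ∧ ∀ (winf : UnitaryGroup.arch F E c M JW → ℂ) (wfin : UnitaryGroup.finAdelic F E c M JW → ℂ)
      (Φinf Ψinf : 𝓢((Fin n → mixedSpace F), ℂ)) (Φfin Ψfin : FinSB F (Fin n)),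
      ∫ h, schwartzPairing F (Fin n) νX (pairRep F E c N M e JV JW s (1, h) (piSchwartzBruhatEquiv F (Fin n) (Φinf ⊗ₜ Φfin)))
          (piSchwartzBruhatEquiv F (Fin n) (Ψinf ⊗ₜ Ψfin)) *
        (winf (UnitaryGroup.archPart F E c M JW h) * wfin (UnitaryGroup.finPart F E c M JW h)) ∂dh =
      ((κ : ℝ) : ℂ) * ((cX : ℂ) *
        ((∫ a, (∫ x, ωinf a Φinf x * conj (Ψinf x) ∂μE) * winf a ∂μa) *
          ∫ b, (∫ y, ((ωfin b Φfin : FinSB F (Fin n)) : (Fin n → FiniteAdeleRing (𝓞 F) F) → ℂ) y *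
            conj ((Ψfin : (Fin n → FiniteAdeleRing (𝓞 F) F) → ℂ) y) ∂μfX) * wfin b ∂μf)) := by
  obtain ⟨κ, hκ, hint⟩ := UnitaryGroup.exists_integral_archPart_mul_finPart F E c M JW dh μa μf
  refine ⟨κ, hκ, fun winf wfin Φinf Ψinf Φfin Ψfin => ?_⟩
  -- pointwise: `h = (h_∞, 1)(1, h_f)` and `hω`, then the pairing of pure tensors (written as β-redexes of the two local
  -- factors, so that `hint` applies syntactically)
  have hpt : ∀ h : UnitaryGroup.adelic F E c M JW,
      schwartzPairing F (Fin n) νX (pairRep F E c N M e JV JW s (1, h) (piSchwartzBruhatEquiv F (Fin n) (Φinf ⊗ₜ Φfin)))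
          (piSchwartzBruhatEquiv F (Fin n) (Ψinf ⊗ₜ Ψfin)) *
        (winf (UnitaryGroup.archPart F E c M JW h) * wfin (UnitaryGroup.finPart F E c M JW h)) =
      (fun a : UnitaryGroup.arch F E c M JW => (cX : ℂ) * ((∫ x, ωinf a Φinf x * conj (Ψinf x) ∂μE) * winf a))
          (UnitaryGroup.archPart F E c M JW h) *
        (fun b : UnitaryGroup.finAdelic F E c M JW =>
          (∫ y, ((ωfin b Φfin : FinSB F (Fin n)) : (Fin n → FiniteAdeleRing (𝓞 F) F) → ℂ) y *
            conj ((Ψfin : (Fin n → FiniteAdeleRing (𝓞 F) F) → ℂ) y) ∂μfX) * wfin b)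
          (UnitaryGroup.finPart F E c M JW h) := by
    intro h
    have key : pairRep F E c N M e JV JW s (1, h) (piSchwartzBruhatEquiv F (Fin n) (Φinf ⊗ₜ Φfin)) =
        piSchwartzBruhatEquiv F (Fin n) (ωinf (UnitaryGroup.archPart F E c M JW h) Φinf ⊗ₜ
          ωfin (UnitaryGroup.finPart F E c M JW h) Φfin) := by
      have hω' := hω (UnitaryGroup.archPart F E c M JW h) (UnitaryGroup.finPart F E c M JW h) Φinf Φfin
      rwa [UnitaryGroup.archToAdelic_mul_finAdelicToAdelic] at hω'
    beta_reduce
    rw [key, schwartzPairing_tmul_tmul F (Fin n) hνX]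
    ring
  refine (integral_congr_ae (Filter.Eventually.of_forall hpt)).trans ?_
  refine (hint (𝕜 := ℂ) (fun a : UnitaryGroup.arch F E c M JW =>
      (cX : ℂ) * ((∫ x, ωinf a Φinf x * conj (Ψinf x) ∂μE) * winf a))
    (fun b : UnitaryGroup.finAdelic F E c M JW =>
      (∫ y, ((ωfin b Φfin : FinSB F (Fin n)) : (Fin n → FiniteAdeleRing (𝓞 F) F) → ℂ) y *
        conj ((Ψfin : (Fin n → FiniteAdeleRing (𝓞 F) F) → ℂ) y) ∂μfX) * wfin b)).trans ?_
  -- `hint` is stated over `RCLike 𝕜`: its scalar is `algebraMap ℝ ℂ κ`; read it as `(κ : ℂ)`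
  rw [integral_const_mul, ← Complex.coe_algebraMap]
  ring

/-! ## §2 The archimedean eigenvector -/

/-- **At an archimedean EIGENVECTOR the `U(W)(𝔸)`-coefficient is `κ·c·vol(U(W)(E⊗ℝ))·⟨Φ_∞,Ψ_∞⟩_∞` times the FINITE coefficient**:
`ω_∞(a)Φ_∞ = χ_∞(a)Φ_∞` (`χ_∞` unitary), weight `\overline{χ_∞(h_∞)}·w_f(h_f)`. [cite: Li1992, Thm 2.1 (27) p. 184; §5]
[cite: Liu2021, proof of Prop. 4.13, l. 2145; App. D Lem. D.2 (2)] -/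
theorem exists_integral_coeff_pairRep_eq_of_eigen [SFinite μE] [SFinite μfX]
    (hνX : νX = cX • (μE.prod μfX).map (piAdeleSplit F (Fin n)))
    [BorelSpace (UnitaryGroup.adelic F E c M JW)] [BorelSpace (UnitaryGroup.arch F E c M JW)]
    [BorelSpace (UnitaryGroup.finAdelic F E c M JW)] [dh.IsHaarMeasure] [μa.IsHaarMeasure] [μf.IsHaarMeasure]
    (hω : ∀ (a : UnitaryGroup.arch F E c M JW) (b : UnitaryGroup.finAdelic F E c M JW)
      (Φinf : 𝓢((Fin n → mixedSpace F), ℂ)) (Φfin : FinSB F (Fin n)),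
      pairRep F E c N M e JV JW s (1, UnitaryGroup.archToAdelic F E c M JW a * UnitaryGroup.finAdelicToAdelic F E c M JW b)
          (piSchwartzBruhatEquiv F (Fin n) (Φinf ⊗ₜ Φfin)) =
        piSchwartzBruhatEquiv F (Fin n) (ωinf a Φinf ⊗ₜ ωfin b Φfin)) :
    ∃ κ : ℝ≥0, 0 < κ ∧ ∀ {Φinf : 𝓢((Fin n → mixedSpace F), ℂ)} {χinf : UnitaryGroup.arch F E c M JW → ℂ},
      (∀ a, χinf a * conj (χinf a) = 1) → (∀ a, ωinf a Φinf = χinf a • Φinf) →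
      ∀ (wfin : UnitaryGroup.finAdelic F E c M JW → ℂ) (Ψinf : 𝓢((Fin n → mixedSpace F), ℂ)) (Φfin Ψfin : FinSB F (Fin n)),
      ∫ h, schwartzPairing F (Fin n) νX (pairRep F E c N M e JV JW s (1, h) (piSchwartzBruhatEquiv F (Fin n) (Φinf ⊗ₜ Φfin)))
          (piSchwartzBruhatEquiv F (Fin n) (Ψinf ⊗ₜ Ψfin)) *
        (conj (χinf (UnitaryGroup.archPart F E c M JW h)) * wfin (UnitaryGroup.finPart F E c M JW h)) ∂dh =
      ((κ : ℝ) : ℂ) * (cX : ℂ) * (μa.real Set.univ : ℂ) * (∫ x, Φinf x * conj (Ψinf x) ∂μE) *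
        ∫ b, (∫ y, ((ωfin b Φfin : FinSB F (Fin n)) : (Fin n → FiniteAdeleRing (𝓞 F) F) → ℂ) y *
          conj ((Ψfin : (Fin n → FiniteAdeleRing (𝓞 F) F) → ℂ) y) ∂μfX) * wfin b ∂μf := by
  obtain ⟨κ, hκ, h⟩ := exists_integral_coeff_pairRep_eq F E c N M e JV JW s dh μa μf ωinf ωfin hνX hω
  refine ⟨κ, hκ, fun {Φinf} {χinf} hχ heig wfin Ψinf Φfin Ψfin => ?_⟩
  rw [h (fun a => conj (χinf a)) wfin Φinf Ψinf Φfin Ψfin,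
    integral_archCoeff_mul_conj_of_eigen F (Fin n) ωinf μa hχ heig Ψinf]
  ring

/-- **Non-vanishing passes to the finite adeles**: under `hω`, at an archimedean eigenvector with `⟨Φ_∞, Ψ_∞⟩_∞ ≠ 0`,
`c ≠ 0` and `vol(U(W)(E ⊗ ℝ)) < ∞`, the `U(W)(𝔸)`-Fourier coefficient is non-zero IFF the finite one
`∫_{U(W)(𝔸_{F,f})} ⟨ω_f(b)Φ_f, Ψ_f⟩_f w_f(b) db` is. [cite: Li1992, Thm 2.1 (27) p. 184; §5]
[cite: Liu2021, proof of Prop. 4.13, l. 2145] -/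
theorem integral_coeff_pairRep_ne_zero_iff_of_eigen [SFinite μE] [SFinite μfX]
    (hνX : νX = cX • (μE.prod μfX).map (piAdeleSplit F (Fin n))) (hcX : cX ≠ 0)
    [BorelSpace (UnitaryGroup.adelic F E c M JW)] [BorelSpace (UnitaryGroup.arch F E c M JW)]
    [BorelSpace (UnitaryGroup.finAdelic F E c M JW)] [dh.IsHaarMeasure] [μa.IsHaarMeasure] [μf.IsHaarMeasure]
    [IsFiniteMeasure μa]
    (hω : ∀ (a : UnitaryGroup.arch F E c M JW) (b : UnitaryGroup.finAdelic F E c M JW)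
      (Φinf : 𝓢((Fin n → mixedSpace F), ℂ)) (Φfin : FinSB F (Fin n)),
      pairRep F E c N M e JV JW s (1, UnitaryGroup.archToAdelic F E c M JW a * UnitaryGroup.finAdelicToAdelic F E c M JW b)
          (piSchwartzBruhatEquiv F (Fin n) (Φinf ⊗ₜ Φfin)) =
        piSchwartzBruhatEquiv F (Fin n) (ωinf a Φinf ⊗ₜ ωfin b Φfin))
    {Φinf : 𝓢((Fin n → mixedSpace F), ℂ)} {χinf : UnitaryGroup.arch F E c M JW → ℂ}
    (hχ : ∀ a, χinf a * conj (χinf a) = 1) (heig : ∀ a, ωinf a Φinf = χinf a • Φinf)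
    (wfin : UnitaryGroup.finAdelic F E c M JW → ℂ) {Ψinf : 𝓢((Fin n → mixedSpace F), ℂ)}
    (hΦΨ : ∫ x, Φinf x * conj (Ψinf x) ∂μE ≠ 0) (Φfin Ψfin : FinSB F (Fin n)) :
    (∫ h, schwartzPairing F (Fin n) νX (pairRep F E c N M e JV JW s (1, h) (piSchwartzBruhatEquiv F (Fin n) (Φinf ⊗ₜ Φfin)))
          (piSchwartzBruhatEquiv F (Fin n) (Ψinf ⊗ₜ Ψfin)) *
        (conj (χinf (UnitaryGroup.archPart F E c M JW h)) * wfin (UnitaryGroup.finPart F E c M JW h)) ∂dh) ≠ 0 ↔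
      (∫ b, (∫ y, ((ωfin b Φfin : FinSB F (Fin n)) : (Fin n → FiniteAdeleRing (𝓞 F) F) → ℂ) y *
          conj ((Ψfin : (Fin n → FiniteAdeleRing (𝓞 F) F) → ℂ) y) ∂μfX) * wfin b ∂μf) ≠ 0 := by
  obtain ⟨κ, hκ, h⟩ := exists_integral_coeff_pairRep_eq_of_eigen F E c N M e JV JW s dh μa μf ωinf ωfin hνX hω
  rw [h hχ heig wfin Ψinf Φfin Ψfin]
  have h1 : ((κ : ℝ) : ℂ) ≠ 0 := by exact_mod_cast hκ.ne'
  have h2 : (cX : ℂ) ≠ 0 := by exact_mod_cast hcX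
  have h3 : (μa.real Set.univ : ℂ) ≠ 0 :=
    Complex.ofReal_ne_zero.2 (ENNReal.toReal_pos (isOpen_univ.measure_ne_zero μa Set.univ_nonempty)
      (measure_ne_top μa _)).ne'
  simp only [ne_eq, mul_eq_zero, h1, h2, h3, hΦΨ, false_or]

/-! ## §3 The reduction of `Θ_{Φ_∞ ⊗ Φ_f}(χ̃) ≠ 0` to one finite Fourier coefficient -/

variable [Algebra.IsQuadraticExtension F E] {δ : E} (hcδ : c δ = -δ) (hδ : δ ≠ 0) {d : F}
  (hd : δ * δ = algebraMap F E d) (hV : TV.IsSymm) (hW : TW.IsSymm) (hVd : IsUnit TV.det) (hWd : IsUnit TW.det)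
  (hJV : JV = TV.map (algebraMap F E)) (hJW : JW = TW.map (algebraMap F E))
variable [LocallyCompactSpace (UnitaryGroup.adelic F E c N JV)] [LocallyCompactSpace (UnitaryGroup.adelic F E c M JW)]
  (hs : (splittingDatum F E c N M e JV JW hcδ hδ hd hV hW hVd hWd hJV hJW).IsCompatible s)
  (hρ : HasThetaMajorants fun (p : UnitaryGroup.adelic F E c N JV × UnitaryGroup.adelic F E c M JW)
    (Φ : piSchwartzBruhat F (Fin n)) => pairRep F E c N M e JV JW s p Φ)
  (SK : Set (piSchwartzBruhat F (Fin n)))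
  (hSK : ∀ (h : UnitaryGroup.adelic F E c M JW) (Φ : piSchwartzBruhat F (Fin n)), Φ ∈ SK →
    pairRep F E c N M e JV JW s (1, h) Φ ∈ SK)
variable [CompactSpace (UnitaryGroup.adelic F E c N JV ⧸ (UnitaryGroup.toAdelic F E c N JV).range)]
  [(UnitaryGroup.toAdelic F E c M JW).range.Normal]
  [MeasurableSpace (UnitaryGroup.adelic F E c M JW ⧸ (UnitaryGroup.toAdelic F E c M JW).range)]
  (μ : Measure (UnitaryGroup.adelic F E c M JW ⧸ (UnitaryGroup.toAdelic F E c M JW).range))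
  [MeasurableSpace (UnitaryGroup.adelic F E c N JV ⧸ (UnitaryGroup.toAdelic F E c N JV).range)]
  (ν : Measure (UnitaryGroup.adelic F E c N JV ⧸ (UnitaryGroup.toAdelic F E c N JV).range))

/-- **THE THETA LIFT `Θ_{Φ_∞ ⊗ Φ_f}(χ̃)` OF AN AUTOMORPHIC CHARACTER OF `U(W)` IS NON-ZERO as soon as**: (26) holds for the
pair's theta-kernel datum (`hR` — the conclusion of `Li1992.RallisInnerProductFormulaUnitaryDualPair`), `ω_ψ ∘ s_pair` factorises
on `U(W)(𝔸) = U(W)(E ⊗ ℝ)·U(W)(𝔸_{F,f})` (`hω`), the character reads `\overline{χ̃(h̄)} = \overline{χ_∞(h_∞)} · w_f(h_f)` (`hχw`),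
`Φ_∞` is an `ω_∞`-eigenvector of unitary eigencharacter `χ_∞` with `⟨Φ_∞, Ψ_∞⟩_∞ ≠ 0`, `vol(U(W)(E ⊗ ℝ)) < ∞`, and ONE finite
Fourier coefficient `∫_{U(W)(𝔸_{F,f})} ⟨ω_f(b)Φ_f, Ψ_f⟩_f w_f(b) db ≠ 0`; then also `Θ_{Ψ_∞ ⊗ Ψ_f}(χ̃) ≠ 0`.  (`μ` finite,
charging open sets; `ν_X = c · split_*(μ_∞ ⊗ μ_f)`, `c ≠ 0`.) [cite: Li1992, p. 178 and Thm 2.1 (26)–(27) p. 184; §5]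
[cite: Liu2021, proof of Prop. 4.13, l. 2145; App. D Lem. D.2 (2)] [cite: Weil1964, Chap. III n° 37–41] -/
theorem thetaLift_charCM_tmul_ne_zero_of_finCoeff_ne_zero [SFinite μE] [SFinite μfX]
    (hνX : νX = cX • (μE.prod μfX).map (piAdeleSplit F (Fin n))) (hcX : cX ≠ 0)
    [BorelSpace (UnitaryGroup.adelic F E c M JW)] [BorelSpace (UnitaryGroup.arch F E c M JW)]
    [BorelSpace (UnitaryGroup.finAdelic F E c M JW)] [dh.IsHaarMeasure] [μa.IsHaarMeasure] [μf.IsHaarMeasure]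
    [IsFiniteMeasure μa] [IsFiniteMeasure μ] [μ.IsOpenPosMeasure]
    (hR : (thetaKernelDatum F E c N M e JV JW hcδ hδ hd hV hW hVd hWd hJV hJW s hs hρ SK hSK).RallisInnerProductIdentity
      (schwartzPairing F (Fin n) νX) dh μ ν)
    (hω : ∀ (a : UnitaryGroup.arch F E c M JW) (b : UnitaryGroup.finAdelic F E c M JW)
      (Φinf : 𝓢((Fin n → mixedSpace F), ℂ)) (Φfin : FinSB F (Fin n)),
      pairRep F E c N M e JV JW s (1, UnitaryGroup.archToAdelic F E c M JW a * UnitaryGroup.finAdelicToAdelic F E c M JW b)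
          (piSchwartzBruhatEquiv F (Fin n) (Φinf ⊗ₜ Φfin)) =
        piSchwartzBruhatEquiv F (Fin n) (ωinf a Φinf ⊗ₜ ωfin b Φfin))
    (χ : PontryaginDual (UnitaryGroup.adelic F E c M JW ⧸ (UnitaryGroup.toAdelic F E c M JW).range))
    {χinf : UnitaryGroup.arch F E c M JW → ℂ} (hχ : ∀ a, χinf a * conj (χinf a) = 1)
    {wfin : UnitaryGroup.finAdelic F E c M JW → ℂ}
    (hχw : ∀ h : UnitaryGroup.adelic F E c M JW, conj ((χ (QuotientGroup.mk h) : Circle) : ℂ) =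
      conj (χinf (UnitaryGroup.archPart F E c M JW h)) * wfin (UnitaryGroup.finPart F E c M JW h))
    {Φinf Ψinf : 𝓢((Fin n → mixedSpace F), ℂ)} (heig : ∀ a, ωinf a Φinf = χinf a • Φinf)
    (hΦΨ : ∫ x, Φinf x * conj (Ψinf x) ∂μE ≠ 0) {Φfin Ψfin : FinSB F (Fin n)}
    (hfin : (∫ b, (∫ y, ((ωfin b Φfin : FinSB F (Fin n)) : (Fin n → FiniteAdeleRing (𝓞 F) F) → ℂ) y *
          conj ((Ψfin : (Fin n → FiniteAdeleRing (𝓞 F) F) → ℂ) y) ∂μfX) * wfin b ∂μf) ≠ 0) :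
    (thetaKernelDatum F E c N M e JV JW hcδ hδ hd hV hW hVd hWd hJV hJW s hs hρ SK hSK).thetaLift μ
        (piSchwartzBruhatEquiv F (Fin n) (Φinf ⊗ₜ Φfin)) (charCM χ) ≠ 0 ∧
      (thetaKernelDatum F E c N M e JV JW hcδ hδ hd hV hW hVd hWd hJV hJW s hs hρ SK hSK).thetaLift μ
        (piSchwartzBruhatEquiv F (Fin n) (Ψinf ⊗ₜ Ψfin)) (charCM χ) ≠ 0 := by
  refine hR.thetaLift_charCM_ne_zero_of_fourierCoeff_ne_zero' ?_
  -- the integrand of the criterion IS the `U(W)(𝔸)`-coefficient with weight `conj χ_∞ ⊗ w_f`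
  simp_rw [thetaKernelDatum_act_s, hχw]
  exact (integral_coeff_pairRep_ne_zero_iff_of_eigen F E c N M e JV JW s dh μa μf ωinf ωfin hνX hcX hω hχ heig wfin hΦΨ
    Φfin Ψfin).2 hfin

end Literature.NumberTheory.GelbartRogawski1991.UnitaryDualPair

end
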